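import Summits.QuantumFields.YangMills.Theorems.BalabanUVNodesN27AtAllPinsOfRecord13CoPHVCutBFreeLetters
import Summits.QuantumFields.YangMills.Theorems.BalabanUVNodesN27AtAllPinsOfRecord13CoPHVCutFSCKingMechanism
import Summits.QuantumFields.YangMills.Theorems.BalabanUVNodesN27AtAllPinsOfRecord13CoPHVCutFSCKingMechanismZ4

/-!
# ★ APKᴮ ∕ APKZᴮ — THIS LINEAGE's ALL-PINS STOREYS IN KING's THREE-FACTOR-MECHANISM KERNEL CURRENCIES (windowed APK p615780 · ℤ⁴-limiting APKZ p617629) RE-CONCLUDED IN THE (B)-FREE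
# SPINE BODY CURRENCY (FILE 1 `…N27SpineBodyBFree13CoPH`, FILE 2 APᴮ, FILE 3 APFᴮ): the same displayed rows (the four pins · `h16` · `hs hκ hcr hρ` · `hr hinc h9` · KING's MECHANISM ROWS
# through APK §0 ∕ APKZ §0 BY NAME · `hsel hζm` · keyed N20 ∕ N21 witnesses), the N19′ face `h19` `ForSmallCouplings`-guarded and **(B)-FREE**, conclusion = the body at every guarded
# admissible tuple of `Rg` — serving K3⁷'s display, K3⁸'s display `SpineGivenEndpointR13SepCoPHV` AT EVERY VERSION SLOT (rev 28, recipe (δⱽ); FILE 1 §3) and the old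
# `Spine (IsRecordOfRecord₁₃CCoPHOn Rg)` (FILE 1 §2)
# (cell `pub-ymgap`, HUMAN RULING D-0062 Track A, R134 seat `pub-ymgap-dag-n27-c` (N27 B5 composite, s2) gen 15, HOME trigger (t3⁗) «plan K3 v6 ∕ rev 28»; `--kind proof --supports
# stmt-QuantumFields-20544 --as helper`; COUNT-NEUTRAL; THEOREMS ONLY, 0 `def`, 0 `sorry`; `N`-generic, `K₀`-generic, regime-generic; NO Theses import)

WHAT IS KERNEL-CHECKED ([bookkeeping]; the parents' §1 statements with the `(B) → EndpointExistence →` prefix of `h19` DROPPED and the conclusion the body; proofs = the parents' (§0 producers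
BY NAME, then APFᴮ §1 ∕ APᴮ §1); generator `pub-ymgap-dag-n27-c/lean/g15-drafts/genB.py`).
* §1 ★★★ `bodyBFree₁₃CoPH_of_v5pins_at_crOfRecord₁₃VAt_cut_of_kingMechanism` (APKᴮ, windowed kernels: APK §0 `windowedRowsOfRecord₁₃_guarded_of_kingMechanism` ⟹ `hS` ∧ `hW`).
* §2 ★★★ `bodyBFree₁₃CoPH_of_v5pins_at_crOfRecord₁₃VAt_cut_of_kingMechanismZ4` (APKZᴮ, limiting kernels on ℤ⁴: APKZ §0 `kernelRowsOfRecord₁₃_guarded_of_kingMechanismZ4` ⟹ `hdec` ∧ `h18`;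
  `h22 ⟸` dag-n18-w2).
The live-line editions are `Rg := G ∧ LiveSel`, `hsel := fun _ _ _ hRg _ ↦ ⟨_, hRg.2⟩` — instantiated by the leaves, not restated.

HONEST FRAMING.  COMPOSITE-node bookkeeping BY NAME; NOT a discharge: King's p. 665 mechanism sentence typed for Bałaban's (1.20) kernels is NOT PRINTED for d = 4 and NOT proved; every
displayed row is a HYPOTHESIS inhabited for no family today (K0⁷ OPEN) or a decided MODEL behind a pin; nothing of Bałaban's or King's asserted or instantiated; (5.10), NE-estimates NOT
proved; N14–N22 ∕ N27 NOT discharged; K3⁷ 20544 ASIDE, K3⁸ `SpineGivenEndpointR13SepCoPHV` = stmt-QuantumFields-27366 OPEN and NOT claimed (rev 28∕29; v1.1 docstring note); the plan's skeletons untouched; counts UNMOVED (typed 28∕28 · discharged 5∕27, A 5∕28); one finite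
four-torus programme at fixed `ε` — NOT ℝ⁴, NOT infinite volume, NOT OS, NOT a mass gap, NOT Clay.  No decl below carries a cite tag.
-/

set_option autoImplicit false

namespace Summit.QuantumFields.YangMills.Theorems.BalabanUVNodesN27SpineRecord

open scoped BigOperators Matrix.Norms.L2Operator
open Literature.MathematicalPhysics.QuantumFieldTheory.Balaban1983to89
open Literature.MathematicalPhysics.QuantumFieldTheory.Balaban1983to89.T4Continuum
open Literature.MathematicalPhysics.QuantumFieldTheory.Balaban1983to89.Node00
open Literature.MathematicalPhysics.QuantumFieldTheory.Balaban1983to89.B12Sec2to5 (betaPrime510 l1)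
open Literature.MathematicalPhysics.QuantumFieldTheory.Balaban1983to89.FlowStep (Box)
open Literature.MathematicalPhysics.QuantumFieldTheory.Balaban1983to89.Node00.U3OfKernels (objectsOfRecord₁₃ KernelDecayOfRecord₁₃)
open Literature.MathematicalPhysics.QuantumFieldTheory.Balaban1983to89.Node00.U3KernelLetters (GeometricIncrementsOfRecord₁₃ WindowedNE9OfRecord₁₃ WindowedDecayOfRecord₁₃
  WindowedStepRateOfRecord₁₃)
open T4WeightBudget (RelWeightBound)
open T4IndicatorShell (ShellWeightBound)
open T4ContinuumYM4Torus (ForSmallCouplings)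
open T4ApexHybrid (StringwiseHybridNE7)
open Summit.QuantumFields.BalabanUV.T4Continuum.Spine
open YMDAG.UVSplit
open Summit.QuantumFields.BalabanUV.T4Continuum.MinimalActionRate (sfClass)
open Summit.QuantumFields.YangMills.BalabanUVNodes.N19TargetClassWeightsE1Keyed
open Summit.QuantumFields.YangMills.BalabanUVNodes.N16HolderDefs (N16HolderAt)
open Summit.QuantumFields.YangMills.BalabanUVNodes.SpineRatesHolder (RatesHolderAt)
open YMDAG.N14.TopBorn (Ne1PinnedOfRecord n14At_rateCarriersOfRecord₁₃CoPH_of_pinned)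
open Summit.QuantumFields.YangMills.BalabanUVNodes.N15.GenuineRecord (fullGSizedObjects n15At_fullGSizedObjects_family)
open Summit.QuantumFields.YangMills.BalabanUVNodes.N15.AtKeyedHome (neZero_blockFactor)
open Summit.QuantumFields.YangMills.BalabanUVNodes.N16PinnedLayer13CoPH (N16PinnedLoose rateCarriers_ne3_of_pinnedLoose)
open YMDAG.N18.KernelStepRateKingMechanism (windowedStepRateOfRecord₁₃_of_threeFactorRates windowedStepRateOfRecord₁₃_mono windowedDecayOfRecord₁₃_of_threeFactorSizes
  windowedDecayOfRecord₁₃_anti)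
open Matrix Filter
open Literature.MathematicalPhysics.QuantumFieldTheory.Balaban1983to89.B12Decay510Window (K₁)
open Literature.MathematicalPhysics.QuantumFieldTheory.Balaban1983to89.T4OutputRate (Window)
open Literature.MathematicalPhysics.QuantumFieldTheory.Balaban1983to89.Node00.U3OfKernels (objectsOfRecord₁₃ KernelDecayOfRecord₁₃ pt bg)
open YMDAG.N18.PolLimitRate (n22At_u3OfRecord₁₃_objectsOfRecord₁₃_of_geometricIncrements_of_windowedNE9)
open YMDAG.N18.KernelStepRateKingMechanism (kernelStepRateOfRecord₁₃_of_threeFactorRates_zlattice kernelStepRateOfRecord₁₃_mono kernelDecayOfRecord₁₃_of_threeFactorSizes_zlattice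
  kernelDecayOfRecord₁₃_anti)
open YMDAG.N18.AtRecordOfKernelLetters (n18At_u3OfRecord₁₃_objectsOfRecord₁₃_of_kernelStepRateOfRecord₁₃)

variable {N : ℕ} [NeZero N] (K₀ : ℕ)
  (jc : (F : T4Family) → (θ : Stage13HParams F N) → θ.Provisos₁₃CoPH F N → (ℕ → ℝ) → List (ULoop F) → ℕ → ℕ)
  (sh : ShellSplit₁₃CoPH N K₀) (β : ℝ) (𝔯 : RateReading₁₃CoPH N)
  (ksel : (F : T4Family) → (θ : Stage13HParams F N) → θ.Provisos₁₃CoPH F N → (ℕ → ℝ) → List (ULoop F) → ℕ)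
  (ℓ : (F : T4Family) → Stage13HParams F N → U3Letters₁₁) (s : (F : T4Family) → Stage13HParams F N → ℕ) (r : (F : T4Family) → Stage13HParams F N → ℝ)
  (ℓ₃ : T4Family → NE3Letters₁₁) (B : T4Family → ℝ)

/-! ## §1 WINDOWED-KERNEL King currency (APKᴮ) -/

section King

variable {PK : (F : T4Family) → Stage13HParams F N → ℕ → ℕ → Type*} {βK : (F : T4Family) → Stage13HParams F N → ℕ → ℕ → Type*}
  [∀ F θ K k, Fintype (βK F θ K k)]
  (ρd : (F : T4Family) → (θ : Stage13HParams F N) → (K k : ℕ) → PK F θ K k → PK F θ K k → ℝ)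
  (q : (F : T4Family) → (θ : Stage13HParams F N) → (K k : ℕ) → βK F θ K k → PK F θ K k)
  (p₁ p₂ : (F : T4Family) → (θ : Stage13HParams F N) → (K k : ℕ) → Fin 4 → Fin 4 → (Fin 4 → ℤ) → PK F θ K k)
  (uA vA : (F : T4Family) → (θ : Stage13HParams F N) → (K k : ℕ) → (Fin (k + 1) → ℝ) → Fin 4 → Fin 4 → (Fin 4 → ℤ) → βK F θ K k → ℝ)
  (CA : (F : T4Family) → (θ : Stage13HParams F N) → (K k : ℕ) → (Fin (k + 1) → ℝ) → Fin 4 → Fin 4 → (Fin 4 → ℤ) → Matrix (βK F θ K k) (βK F θ K k) ℝ)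
  (uB vB : (F : T4Family) → (θ : Stage13HParams F N) → (K k : ℕ) → (Fin (k + 2) → ℝ) → Fin 4 → Fin 4 → (Fin 4 → ℤ) → βK F θ K k → ℝ)
  (CB : (F : T4Family) → (θ : Stage13HParams F N) → (K k : ℕ) → (Fin (k + 2) → ℝ) → Fin 4 → Fin 4 → (Fin 4 → ℤ) → Matrix (βK F θ K k) (βK F θ K k) ℝ)
  (κK θK VK sA sC sB cA cC cB : (F : T4Family) → Stage13HParams F N → ℝ)

/-- ★★★ **APKᴮ — THE (B)-FREE SPINE BODY ON A REGIME FROM ALL FOUR PINS, THE N18 ROW `hS` AND THE (D4) ROW `hW` PRODUCED BY KING's THREE-FACTOR MECHANISM** = APK §1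
`spine_rec13CCoPHOn_of_v5pins_fsc_at_crOfRecord₁₃VAt_cut_of_kingMechanism` (p615780) IN THE BODY CURRENCY: APK §0 `windowedRowsOfRecord₁₃_guarded_of_kingMechanism` (the sixteen King rows on the
record's WINDOWED kernels ⟹ `hS` ∧ `hW`, BY NAME) then APFᴮ §1; the N19′ face `h19` `ForSmallCouplings`-guarded and (B)-FREE.  NOT a discharge: King's p. 665 sentence typed for Bałaban's
(1.20) kernels is NOT PRINTED for d = 4 and NOT proved; every row a HYPOTHESIS or a decided MODEL (0∕1 today). [bookkeeping] -/
theorem bodyBFree₁₃CoPH_of_v5pins_at_crOfRecord₁₃VAt_cut_of_kingMechanism (Rg : (F : T4Family) → Stage13HParams F N → Prop)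
    (hpin1 : Ne1PinnedOfRecord 𝔯)
    (hpin2 : ∃ (b aS : ℝ) (ν μ α β' : Fin 4) (c35 p : ℝ), 0 < b ∧ 0 < aS ∧
      ∀ (F : T4Family) (θ : Stage13HParams F N) (hP : θ.Provisos₁₃CoPH F N) (g₀ : ℕ → ℝ) (os : List (ULoop F)) (k : ℕ),
        (𝔯.lit F θ hP g₀ os).ne2 k = haveI := neZero_blockFactor F; fullGSizedObjects 3 F.hL b aS ν μ α β' c35 p)
    (hpinL : N16PinnedLoose 𝔯 ℓ₃ B)
    (hpin : ∀ (F : T4Family) (θ : Stage13HParams F N) (hP : θ.Provisos₁₃CoPH F N) (g₀ : ℕ → ℝ) (os : List (ULoop F)),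
      (𝔯.lit F θ hP g₀ os).u3 = objectsOfRecord₁₃ F N θ.toStage13Params (ℓ F θ))
    (h16 : ∀ (F : T4Family), (∃ θ : Stage13HParams F N, θ.Provisos₁₃CoPH F N ∧ Rg F θ ∧ θ.Admissible F N) →
      N16HolderAt (ne3OfRecord₁₁ F { ne3ConstLayerOfRecord₁₁ F N (ℓ₃ F) with
        dom := {V | V ∈ ne3DomOfRecord₁₁ F N 0 0 ∧ V ∈ sfClass 4 F.L (ne3NperOfRecord₁₁ F 0 0) ((ℓ₃ F).ε / B F) 0} }) β)
    (hs : ∀ (F : T4Family) (θ : Stage13HParams F N), θ.Provisos₁₃CoPH F N → Rg F θ → θ.Admissible F N → (ℓ F θ).Signs)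
    (hκ : ∀ (F : T4Family) (θ : Stage13HParams F N), θ.Provisos₁₃CoPH F N → Rg F θ → θ.Admissible F N → 0 < (ℓ F θ).κ)
    (hcr : ∀ (F : T4Family) (θ : Stage13HParams F N), θ.Provisos₁₃CoPH F N → Rg F θ → θ.Admissible F N →
      betaPrime510 4 1 (ℓ F θ).κ ≤ (ℓ F θ).cr)
    (hρ : ∀ (F : T4Family) (θ : Stage13HParams F N), θ.Provisos₁₃CoPH F N → Rg F θ → θ.Admissible F N →
      0 ≤ (ℓ F θ).ρ ∧ (ℓ F θ).ρ < 1)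
    (hr : ∀ (F : T4Family) (θ : Stage13HParams F N), θ.Provisos₁₃CoPH F N → Rg F θ → θ.Admissible F N → r F θ < 1)
    (hinc : ∀ (F : T4Family) (θ : Stage13HParams F N), θ.Provisos₁₃CoPH F N → Rg F θ → θ.Admissible F N →
      GeometricIncrementsOfRecord₁₃ F N θ.toStage13Params (r F θ))
    (h9 : ∀ (F : T4Family) (θ : Stage13HParams F N), θ.Provisos₁₃CoPH F N → Rg F θ → θ.Admissible F N →
      WindowedNE9OfRecord₁₃ F N θ.toStage13Params (ℓ F θ).κ (ℓ F θ).moduli)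
    (hks : ∀ (F : T4Family) (θ : Stage13HParams F N), θ.Provisos₁₃CoPH F N → Rg F θ → θ.Admissible F N →
      0 ≤ κK F θ ∧ 0 ≤ θK F θ ∧ 0 ≤ sA F θ ∧ 0 ≤ sC F θ ∧ 0 ≤ sB F θ ∧ 0 ≤ cA F θ ∧ 0 ≤ cC F θ ∧ 0 ≤ cB F θ)
    (hρ0 : ∀ (F : T4Family) (θ : Stage13HParams F N) (K k : ℕ) (t t' : PK F θ K k), 0 ≤ ρd F θ K k t t')
    (hρtri : ∀ (F : T4Family) (θ : Stage13HParams F N) (K k : ℕ) (t t' t'' : PK F θ K k), ρd F θ K k t t'' ≤ ρd F θ K k t t' + ρd F θ K k t' t'')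
    (hd : ∀ (F : T4Family) (θ : Stage13HParams F N) (K k : ℕ) (μ ν : Fin 4) (x : Fin 4 → ℤ), l1 x ≤ ρd F θ K k (p₁ F θ K k μ ν x) (p₂ F θ K k μ ν x))
    (hV : ∀ (F : T4Family) (θ : Stage13HParams F N), θ.Provisos₁₃CoPH F N → Rg F θ → θ.Admissible F N →
      ∀ (K k : ℕ) (t : PK F θ K k), ∑ i, Real.exp (-(κK F θ / 2 * ρd F θ K k t (q F θ K k i))) ≤ VK F θ)
    (hA : ∀ (F : T4Family) (θ : Stage13HParams F N), θ.Provisos₁₃CoPH F N → Rg F θ → θ.Admissible F N →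
      (letI := θ.instVβ₁; letI := θ.instVβ₂; letI := θ.instιβ
      ∀ (k : ℕ) (v : Fin (k + 1) → ℝ), v ∈ Box θ.γ k → ∀ (μ ν : Fin 4) (x : Fin 4 → ℤ), ∀ᶠ K in atTop,
        polWindow F K (k + 1) (mergedTermFamilyMatT F N (TβOfRecord₁₃ F N) (chiβOfRecord₁₃ F N θ.toStage13Params) θ.εbg k v K) θ.ρ8 θ.bV μ ν x =
          uA F θ K k v μ ν x ⬝ᵥ (CA F θ K k v μ ν x *ᵥ vA F θ K k v μ ν x)))
    (hB : ∀ (F : T4Family) (θ : Stage13HParams F N), θ.Provisos₁₃CoPH F N → Rg F θ → θ.Admissible F N →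
      (letI := θ.instVβ₁; letI := θ.instVβ₂; letI := θ.instιβ
      ∀ (k : ℕ) (w : Fin (k + 2) → ℝ), w ∈ Box θ.γ (k + 1) → ∀ (μ ν : Fin 4) (x : Fin 4 → ℤ), ∀ᶠ K in atTop,
        polWindow F (K + s F θ) (k + 1 + 1) (mergedTermFamilyMatT F N (TβOfRecord₁₃ F N) (chiβOfRecord₁₃ F N θ.toStage13Params) θ.εbg (k + 1) w (K + s F θ)) θ.ρ8 θ.bV μ ν x =
          uB F θ K k w μ ν x ⬝ᵥ (CB F θ K k w μ ν x *ᵥ vB F θ K k w μ ν x)))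
    (hu : ∀ (F : T4Family) (θ : Stage13HParams F N), θ.Provisos₁₃CoPH F N → Rg F θ → θ.Admissible F N →
      ∀ (K k : ℕ) (v : Fin (k + 1) → ℝ) (μ ν : Fin 4) (x : Fin 4 → ℤ) (i : βK F θ K k),
        |uA F θ K k v μ ν x i| ≤ sA F θ * Real.exp (-(κK F θ * ρd F θ K k (p₁ F θ K k μ ν x) (q F θ K k i))))
    (hCA : ∀ (F : T4Family) (θ : Stage13HParams F N), θ.Provisos₁₃CoPH F N → Rg F θ → θ.Admissible F N →
      ∀ (K k : ℕ) (v : Fin (k + 1) → ℝ) (μ ν : Fin 4) (x : Fin 4 → ℤ) (i i' : βK F θ K k),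
        |CA F θ K k v μ ν x i i'| ≤ sC F θ * Real.exp (-(κK F θ * ρd F θ K k (q F θ K k i) (q F θ K k i'))))
    (hvA : ∀ (F : T4Family) (θ : Stage13HParams F N), θ.Provisos₁₃CoPH F N → Rg F θ → θ.Admissible F N →
      ∀ (K k : ℕ) (v : Fin (k + 1) → ℝ) (μ ν : Fin 4) (x : Fin 4 → ℤ) (i' : βK F θ K k),
        |vA F θ K k v μ ν x i'| ≤ sB F θ * Real.exp (-(κK F θ * ρd F θ K k (q F θ K k i') (p₂ F θ K k μ ν x))))
    (hCB : ∀ (F : T4Family) (θ : Stage13HParams F N), θ.Provisos₁₃CoPH F N → Rg F θ → θ.Admissible F N →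
      ∀ (K k : ℕ) (w : Fin (k + 2) → ℝ) (μ ν : Fin 4) (x : Fin 4 → ℤ) (i i' : βK F θ K k),
        |CB F θ K k w μ ν x i i'| ≤ sC F θ * Real.exp (-(κK F θ * ρd F θ K k (q F θ K k i) (q F θ K k i'))))
    (hvB : ∀ (F : T4Family) (θ : Stage13HParams F N), θ.Provisos₁₃CoPH F N → Rg F θ → θ.Admissible F N →
      ∀ (K k : ℕ) (w : Fin (k + 2) → ℝ) (μ ν : Fin 4) (x : Fin 4 → ℤ) (i' : βK F θ K k),
        |vB F θ K k w μ ν x i'| ≤ sB F θ * Real.exp (-(κK F θ * ρd F θ K k (q F θ K k i') (p₂ F θ K k μ ν x))))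
    (hdu : ∀ (F : T4Family) (θ : Stage13HParams F N), θ.Provisos₁₃CoPH F N → Rg F θ → θ.Admissible F N →
      ∀ (K k : ℕ) (w : Fin (k + 2) → ℝ) (μ ν : Fin 4) (x : Fin 4 → ℤ) (i : βK F θ K k),
        |uB F θ K k w μ ν x i - uA F θ K k (Fin.tail w) μ ν x i| ≤
          cA F θ * θK F θ ^ (k + 1) * Real.exp (-(κK F θ * ρd F θ K k (p₁ F θ K k μ ν x) (q F θ K k i))))
    (hdC : ∀ (F : T4Family) (θ : Stage13HParams F N), θ.Provisos₁₃CoPH F N → Rg F θ → θ.Admissible F N →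
      ∀ (K k : ℕ) (w : Fin (k + 2) → ℝ) (μ ν : Fin 4) (x : Fin 4 → ℤ) (i i' : βK F θ K k),
        |CB F θ K k w μ ν x i i' - CA F θ K k (Fin.tail w) μ ν x i i'| ≤
          cC F θ * θK F θ ^ (k + 1) * Real.exp (-(κK F θ * ρd F θ K k (q F θ K k i) (q F θ K k i'))))
    (hdv : ∀ (F : T4Family) (θ : Stage13HParams F N), θ.Provisos₁₃CoPH F N → Rg F θ → θ.Admissible F N →
      ∀ (K k : ℕ) (w : Fin (k + 2) → ℝ) (μ ν : Fin 4) (x : Fin 4 → ℤ) (i' : βK F θ K k),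
        |vB F θ K k w μ ν x i' - vA F θ K k (Fin.tail w) μ ν x i'| ≤
          cB F θ * θK F θ ^ (k + 1) * Real.exp (-(κK F θ * ρd F θ K k (q F θ K k i') (p₂ F θ K k μ ν x))))
    (hdom : ∀ (F : T4Family) (θ : Stage13HParams F N), θ.Provisos₁₃CoPH F N → Rg F θ → θ.Admissible F N →
      (ℓ F θ).κ ≤ κK F θ / 2 ∧ θK F θ ≤ (ℓ F θ).θ₅ ∧
        ((cA F θ * sC F θ * sB F θ + sA F θ * cC F θ * sB F θ + sA F θ * sC F θ * cB F θ) * VK F θ ^ 2) * θK F θ ≤ (ℓ F θ).C₅ * (ℓ F θ).θ₅)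
    (hsel : ∀ (F : T4Family) (θ : Stage13HParams F N), θ.Provisos₁₃CoPH F N → Rg F θ → θ.Admissible F N →
      ∃ E : B12.RunParams → ℝ, θ.ppSel = ppSelLiveOfRecord F N θ.ν θ.τ9 E (wOfRecord₉ F N θ.toStage9Params))
    (hζm : ∀ (F : T4Family) (θ : Stage13HParams F N), θ.Provisos₁₃CoPH F N → Rg F θ → θ.Admissible F N → ZetaMeasurable F N θ.ζ)
    (h20 : ∀ (F : T4Family) (θ : Stage13HParams F N) (hP : θ.Provisos₁₃CoPH F N), Rg F θ → θ.Admissible F N →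
      ∀ (g₀ : ℕ → ℝ) (os : List (ULoop F)),
        ∃ W : ℕ → ℝ, RelWeightBound 1 (classSet₁₃ θ K₀ g₀) (weightA₁₃ θ hP K₀ g₀ os) (weightB₁₃ θ hP K₀ g₀ os) (badClass₁₃ θ K₀ g₀ (jc F θ hP g₀ os)) W)
    (h21 : ∀ (F : T4Family) (θ : Stage13HParams F N) (hP : θ.Provisos₁₃CoPH F N), Rg F θ → θ.Admissible F N →
      ∀ (g₀ : ℕ → ℝ) (os : List (ULoop F)),
        ∃ Wsh : ℕ → ℝ, ShellWeightBound 1 (classSet₁₃ θ K₀ g₀) (weightA₁₃ θ hP K₀ g₀ os) (weightB₁₃ θ hP K₀ g₀ os) (sh F θ hP g₀ os).1 (sh F θ hP g₀ os).2 Wsh)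
    (h19 : ∀ (F : T4Family) (θ : Stage13HParams F N) (hP : θ.Provisos₁₃CoPH F N), Rg F θ → θ.Admissible F N →
        ForSmallCouplings (datumOfRecord₁₃CoPH F N θ hP) fun g₀ => ∀ os : List (ULoop F),
          (RatesHolderAt (datumOfRecord₁₃CoPH F N θ hP) (rateCarriersOfRecord₁₃CoPH 𝔯 F θ hP g₀ os (ksel F θ hP g₀ os)) β ∧
              ReadOutAt (datumOfRecord₁₃CoPH F N θ hP) (rateCarriersOfRecord₁₃CoPH 𝔯 F θ hP g₀ os (ksel F θ hP g₀ os)).u3 ∧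
              (0 ≤ (rateCarriersOfRecord₁₃CoPH 𝔯 F θ hP g₀ os (ksel F θ hP g₀ os)).u3.ρ ∧
                (rateCarriersOfRecord₁₃CoPH 𝔯 F θ hP g₀ os (ksel F θ hP g₀ os)).u3.ρ < 1)) →
            letI : DecidableEq (Σ K, SiteSeqKey F (K₀ + K)) := Classical.decEq _
            ∃ δ : ℕ → ℝ, NE7.Core 1 (F.side ^ 4) (classSet₁₃ θ K₀ g₀) (badClass₁₃ θ K₀ g₀ (jc F θ hP g₀ os))
              (fun K t x => weightA₁₃ θ hP K₀ g₀ os K t x - (sh F θ hP g₀ os).1 K t x)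
              (fun K t x => weightB₁₃ θ hP K₀ g₀ os K t x - (sh F θ hP g₀ os).2 K t x) δ ∧ Summable δ)
    (F : T4Family) (θ : Stage13HParams F N) (hP : θ.Provisos₁₃CoPH F N) (hRg : Rg F θ) (hθ : θ.Admissible F N) :
    ForSmallCouplings (datumOfRecord₁₃CoPH F N θ hP) fun g₀ => StringwiseHybridNE7 ((datumOfRecord₁₃CoPH F N θ hP).scheme g₀) := by
  obtain ⟨hS, hW⟩ := windowedRowsOfRecord₁₃_guarded_of_kingMechanism ℓ s ρd q p₁ p₂ uA vA CA uB vB CB κK θK VK sA sC sB cA cC cB Rg hs hks hρ0 hρtri hd hV hA hB hu hCA hvA hCB hvB hdu hdC hdv hdom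
  exact bodyBFree₁₃CoPH_of_v5pins_at_crOfRecord₁₃VAt_cut_of_finiteVolumeLetters K₀ jc sh β 𝔯 ksel ℓ s r ℓ₃ B Rg hpin1 hpin2 hpinL hpin h16 hs hκ hcr hρ hr hinc hS h9 hW
    hsel hζm h20 h21 h19 F θ hP hRg hθ

end King

/-! ## §2 ℤ⁴-LIMITING-KERNEL King currency (APKZᴮ) -/

section KingZ4

variable {βK : (F : T4Family) → Stage13HParams F N → ℕ → Type*} [∀ F θ k, Fintype (βK F θ k)]
  (q : (F : T4Family) → (θ : Stage13HParams F N) → (k : ℕ) → βK F θ k → (Fin 4 → ℤ))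
  (p₁ p₂ : (F : T4Family) → (θ : Stage13HParams F N) → (k : ℕ) → Fin 4 → Fin 4 → (Fin 4 → ℤ) → (Fin 4 → ℤ))
  (uA vA : (F : T4Family) → (θ : Stage13HParams F N) → (ℕ → ℝ) → (k : ℕ) → Fin 4 → Fin 4 → (Fin 4 → ℤ) → βK F θ k → ℝ)
  (CA : (F : T4Family) → (θ : Stage13HParams F N) → (ℕ → ℝ) → (k : ℕ) → Fin 4 → Fin 4 → (Fin 4 → ℤ) → Matrix (βK F θ k) (βK F θ k) ℝ)
  (uB vB : (F : T4Family) → (θ : Stage13HParams F N) → ℝ → (ℕ → ℝ) → (k : ℕ) → Fin 4 → Fin 4 → (Fin 4 → ℤ) → βK F θ k → ℝ)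
  (CB : (F : T4Family) → (θ : Stage13HParams F N) → ℝ → (ℕ → ℝ) → (k : ℕ) → Fin 4 → Fin 4 → (Fin 4 → ℤ) → Matrix (βK F θ k) (βK F θ k) ℝ)
  (κK θK sA sC sB cA cC cB : (F : T4Family) → Stage13HParams F N → ℝ)

/-- ★★★ **APKZᴮ — THE (B)-FREE SPINE BODY ON A REGIME FROM ALL FOUR PINS, AP §1's u3 INPUTS `hdec` ((D4)) AND `h18` (N18) PRODUCED BY KING's THREE-FACTOR MECHANISM ON ℤ⁴
LATTICES FOR THE LIMITING KERNELS** = APKZ §1 `spine_rec13CCoPHOn_of_v5pins_fsc_at_crOfRecord₁₃VAt_cut_of_kingMechanismZ4` (p617629) IN THE BODY CURRENCY: APKZ §0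
`kernelRowsOfRecord₁₃_guarded_of_kingMechanismZ4` BY NAME, `h22 ⟸` dag-n18-w2 `n22At_u3OfRecord₁₃_objectsOfRecord₁₃_of_geometricIncrements_of_windowedNE9`, then APᴮ §1 with `hrows`
discharged behind the pins; the N19′ face `h19` (B)-FREE.  NOT a discharge (as APKᴮ). [bookkeeping] -/
theorem bodyBFree₁₃CoPH_of_v5pins_at_crOfRecord₁₃VAt_cut_of_kingMechanismZ4 (Rg : (F : T4Family) → Stage13HParams F N → Prop)
    (hpin1 : Ne1PinnedOfRecord 𝔯)
    (hpin2 : ∃ (b aS : ℝ) (ν μ α β' : Fin 4) (c35 p : ℝ), 0 < b ∧ 0 < aS ∧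
      ∀ (F : T4Family) (θ : Stage13HParams F N) (hP : θ.Provisos₁₃CoPH F N) (g₀ : ℕ → ℝ) (os : List (ULoop F)) (k : ℕ),
        (𝔯.lit F θ hP g₀ os).ne2 k = haveI := neZero_blockFactor F; fullGSizedObjects 3 F.hL b aS ν μ α β' c35 p)
    (hpinL : N16PinnedLoose 𝔯 ℓ₃ B)
    (hpin : ∀ (F : T4Family) (θ : Stage13HParams F N) (hP : θ.Provisos₁₃CoPH F N) (g₀ : ℕ → ℝ) (os : List (ULoop F)),
      (𝔯.lit F θ hP g₀ os).u3 = objectsOfRecord₁₃ F N θ.toStage13Params (ℓ F θ))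
    (h16 : ∀ (F : T4Family), (∃ θ : Stage13HParams F N, θ.Provisos₁₃CoPH F N ∧ Rg F θ ∧ θ.Admissible F N) →
      N16HolderAt (ne3OfRecord₁₁ F { ne3ConstLayerOfRecord₁₁ F N (ℓ₃ F) with
        dom := {V | V ∈ ne3DomOfRecord₁₁ F N 0 0 ∧ V ∈ sfClass 4 F.L (ne3NperOfRecord₁₁ F 0 0) ((ℓ₃ F).ε / B F) 0} }) β)
    (hs : ∀ (F : T4Family) (θ : Stage13HParams F N), θ.Provisos₁₃CoPH F N → Rg F θ → θ.Admissible F N → (ℓ F θ).Signs)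
    (hκ : ∀ (F : T4Family) (θ : Stage13HParams F N), θ.Provisos₁₃CoPH F N → Rg F θ → θ.Admissible F N → 0 < (ℓ F θ).κ)
    (hcr : ∀ (F : T4Family) (θ : Stage13HParams F N), θ.Provisos₁₃CoPH F N → Rg F θ → θ.Admissible F N →
      betaPrime510 4 1 (ℓ F θ).κ ≤ (ℓ F θ).cr)
    (hρ : ∀ (F : T4Family) (θ : Stage13HParams F N), θ.Provisos₁₃CoPH F N → Rg F θ → θ.Admissible F N →
      0 ≤ (ℓ F θ).ρ ∧ (ℓ F θ).ρ < 1)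
    (hr : ∀ (F : T4Family) (θ : Stage13HParams F N), θ.Provisos₁₃CoPH F N → Rg F θ → θ.Admissible F N → r F θ < 1)
    (hinc : ∀ (F : T4Family) (θ : Stage13HParams F N), θ.Provisos₁₃CoPH F N → Rg F θ → θ.Admissible F N →
      GeometricIncrementsOfRecord₁₃ F N θ.toStage13Params (r F θ))
    (h9 : ∀ (F : T4Family) (θ : Stage13HParams F N), θ.Provisos₁₃CoPH F N → Rg F θ → θ.Admissible F N →
      WindowedNE9OfRecord₁₃ F N θ.toStage13Params (ℓ F θ).κ (ℓ F θ).moduli)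
    (hks : ∀ (F : T4Family) (θ : Stage13HParams F N), θ.Provisos₁₃CoPH F N → Rg F θ → θ.Admissible F N →
      0 < κK F θ ∧ 0 ≤ θK F θ ∧ 0 ≤ sA F θ ∧ 0 ≤ sC F θ ∧ 0 ≤ sB F θ ∧ 0 ≤ cA F θ ∧ 0 ≤ cC F θ ∧ 0 ≤ cB F θ)
    (hq : ∀ (F : T4Family) (θ : Stage13HParams F N) (k : ℕ), Function.Injective (q F θ k))
    (hd : ∀ (F : T4Family) (θ : Stage13HParams F N) (k : ℕ) (μ ν : Fin 4) (z : Fin 4 → ℤ), l1 z ≤ l1 (p₁ F θ k μ ν z - p₂ F θ k μ ν z))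
    (hEA : ∀ (F : T4Family) (θ : Stage13HParams F N), θ.Provisos₁₃CoPH F N → Rg F θ → θ.Admissible F N →
      ∀ g ∈ Window θ.γ, ∀ (k : ℕ) (μ ν : Fin 4) (z : Fin 4 → ℤ),
        (objectsOfRecord₁₃ F N θ.toStage13Params (ℓ F θ)).EA k g PUnit.unit (pt k μ ν z) = uA F θ g k μ ν z ⬝ᵥ (CA F θ g k μ ν z *ᵥ vA F θ g k μ ν z))
    (hEB : ∀ (F : T4Family) (θ : Stage13HParams F N), θ.Provisos₁₃CoPH F N → Rg F θ → θ.Admissible F N →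
      ∀ b : ℝ, 0 < b → b ≤ θ.γ → ∀ g ∈ Window θ.γ, ∀ (k : ℕ) (μ ν : Fin 4) (z : Fin 4 → ℤ),
        (objectsOfRecord₁₃ F N θ.toStage13Params (ℓ F θ)).EB k b g (bg k μ ν z) (pt k μ ν z) = uB F θ b g k μ ν z ⬝ᵥ (CB F θ b g k μ ν z *ᵥ vB F θ b g k μ ν z))
    (hu : ∀ (F : T4Family) (θ : Stage13HParams F N), θ.Provisos₁₃CoPH F N → Rg F θ → θ.Admissible F N →
      ∀ g ∈ Window θ.γ, ∀ (k : ℕ) (μ ν : Fin 4) (z : Fin 4 → ℤ) (i : βK F θ k),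
        |uA F θ g k μ ν z i| ≤ sA F θ * Real.exp (-(κK F θ * l1 (p₁ F θ k μ ν z - q F θ k i))))
    (hCA : ∀ (F : T4Family) (θ : Stage13HParams F N), θ.Provisos₁₃CoPH F N → Rg F θ → θ.Admissible F N →
      ∀ g ∈ Window θ.γ, ∀ (k : ℕ) (μ ν : Fin 4) (z : Fin 4 → ℤ) (i i' : βK F θ k),
        |CA F θ g k μ ν z i i'| ≤ sC F θ * Real.exp (-(κK F θ * l1 (q F θ k i - q F θ k i'))))
    (hvA : ∀ (F : T4Family) (θ : Stage13HParams F N), θ.Provisos₁₃CoPH F N → Rg F θ → θ.Admissible F N →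
      ∀ g ∈ Window θ.γ, ∀ (k : ℕ) (μ ν : Fin 4) (z : Fin 4 → ℤ) (i' : βK F θ k),
        |vA F θ g k μ ν z i'| ≤ sB F θ * Real.exp (-(κK F θ * l1 (q F θ k i' - p₂ F θ k μ ν z))))
    (hCB : ∀ (F : T4Family) (θ : Stage13HParams F N), θ.Provisos₁₃CoPH F N → Rg F θ → θ.Admissible F N →
      ∀ b : ℝ, 0 < b → b ≤ θ.γ → ∀ g ∈ Window θ.γ, ∀ (k : ℕ) (μ ν : Fin 4) (z : Fin 4 → ℤ) (i i' : βK F θ k),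
        |CB F θ b g k μ ν z i i'| ≤ sC F θ * Real.exp (-(κK F θ * l1 (q F θ k i - q F θ k i'))))
    (hvB : ∀ (F : T4Family) (θ : Stage13HParams F N), θ.Provisos₁₃CoPH F N → Rg F θ → θ.Admissible F N →
      ∀ b : ℝ, 0 < b → b ≤ θ.γ → ∀ g ∈ Window θ.γ, ∀ (k : ℕ) (μ ν : Fin 4) (z : Fin 4 → ℤ) (i' : βK F θ k),
        |vB F θ b g k μ ν z i'| ≤ sB F θ * Real.exp (-(κK F θ * l1 (q F θ k i' - p₂ F θ k μ ν z))))
    (hdu : ∀ (F : T4Family) (θ : Stage13HParams F N), θ.Provisos₁₃CoPH F N → Rg F θ → θ.Admissible F N →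
      ∀ b : ℝ, 0 < b → b ≤ θ.γ → ∀ g ∈ Window θ.γ, ∀ (k : ℕ) (μ ν : Fin 4) (z : Fin 4 → ℤ) (i : βK F θ k),
        |uB F θ b g k μ ν z i - uA F θ g k μ ν z i| ≤ cA F θ * θK F θ ^ (k + 1) * Real.exp (-(κK F θ * l1 (p₁ F θ k μ ν z - q F θ k i))))
    (hdC : ∀ (F : T4Family) (θ : Stage13HParams F N), θ.Provisos₁₃CoPH F N → Rg F θ → θ.Admissible F N →
      ∀ b : ℝ, 0 < b → b ≤ θ.γ → ∀ g ∈ Window θ.γ, ∀ (k : ℕ) (μ ν : Fin 4) (z : Fin 4 → ℤ) (i i' : βK F θ k),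
        |CB F θ b g k μ ν z i i' - CA F θ g k μ ν z i i'| ≤ cC F θ * θK F θ ^ (k + 1) * Real.exp (-(κK F θ * l1 (q F θ k i - q F θ k i'))))
    (hdv : ∀ (F : T4Family) (θ : Stage13HParams F N), θ.Provisos₁₃CoPH F N → Rg F θ → θ.Admissible F N →
      ∀ b : ℝ, 0 < b → b ≤ θ.γ → ∀ g ∈ Window θ.γ, ∀ (k : ℕ) (μ ν : Fin 4) (z : Fin 4 → ℤ) (i' : βK F θ k),
        |vB F θ b g k μ ν z i' - vA F θ g k μ ν z i'| ≤ cB F θ * θK F θ ^ (k + 1) * Real.exp (-(κK F θ * l1 (q F θ k i' - p₂ F θ k μ ν z))))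
    (hdom : ∀ (F : T4Family) (θ : Stage13HParams F N), θ.Provisos₁₃CoPH F N → Rg F θ → θ.Admissible F N →
      (ℓ F θ).κ ≤ κK F θ / 2 ∧ θK F θ ≤ (ℓ F θ).θ₅ ∧
        (cA F θ * sC F θ * sB F θ + sA F θ * cC F θ * sB F θ + sA F θ * sC F θ * cB F θ) * K₁ 4 (κK F θ / 2) ^ 2 ≤ (ℓ F θ).C₅)
    (hsel : ∀ (F : T4Family) (θ : Stage13HParams F N), θ.Provisos₁₃CoPH F N → Rg F θ → θ.Admissible F N →
      ∃ E : B12.RunParams → ℝ, θ.ppSel = ppSelLiveOfRecord F N θ.ν θ.τ9 E (wOfRecord₉ F N θ.toStage9Params))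
    (hζm : ∀ (F : T4Family) (θ : Stage13HParams F N), θ.Provisos₁₃CoPH F N → Rg F θ → θ.Admissible F N → ZetaMeasurable F N θ.ζ)
    (h20 : ∀ (F : T4Family) (θ : Stage13HParams F N) (hP : θ.Provisos₁₃CoPH F N), Rg F θ → θ.Admissible F N →
      ∀ (g₀ : ℕ → ℝ) (os : List (ULoop F)),
        ∃ W : ℕ → ℝ, RelWeightBound 1 (classSet₁₃ θ K₀ g₀) (weightA₁₃ θ hP K₀ g₀ os) (weightB₁₃ θ hP K₀ g₀ os) (badClass₁₃ θ K₀ g₀ (jc F θ hP g₀ os)) W)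
    (h21 : ∀ (F : T4Family) (θ : Stage13HParams F N) (hP : θ.Provisos₁₃CoPH F N), Rg F θ → θ.Admissible F N →
      ∀ (g₀ : ℕ → ℝ) (os : List (ULoop F)),
        ∃ Wsh : ℕ → ℝ, ShellWeightBound 1 (classSet₁₃ θ K₀ g₀) (weightA₁₃ θ hP K₀ g₀ os) (weightB₁₃ θ hP K₀ g₀ os) (sh F θ hP g₀ os).1 (sh F θ hP g₀ os).2 Wsh)
    (h19 : ∀ (F : T4Family) (θ : Stage13HParams F N) (hP : θ.Provisos₁₃CoPH F N), Rg F θ → θ.Admissible F N →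
        ForSmallCouplings (datumOfRecord₁₃CoPH F N θ hP) fun g₀ => ∀ os : List (ULoop F),
          (RatesHolderAt (datumOfRecord₁₃CoPH F N θ hP) (rateCarriersOfRecord₁₃CoPH 𝔯 F θ hP g₀ os (ksel F θ hP g₀ os)) β ∧
              ReadOutAt (datumOfRecord₁₃CoPH F N θ hP) (rateCarriersOfRecord₁₃CoPH 𝔯 F θ hP g₀ os (ksel F θ hP g₀ os)).u3 ∧
              (0 ≤ (rateCarriersOfRecord₁₃CoPH 𝔯 F θ hP g₀ os (ksel F θ hP g₀ os)).u3.ρ ∧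
                (rateCarriersOfRecord₁₃CoPH 𝔯 F θ hP g₀ os (ksel F θ hP g₀ os)).u3.ρ < 1)) →
            letI : DecidableEq (Σ K, SiteSeqKey F (K₀ + K)) := Classical.decEq _
            ∃ δ : ℕ → ℝ, NE7.Core 1 (F.side ^ 4) (classSet₁₃ θ K₀ g₀) (badClass₁₃ θ K₀ g₀ (jc F θ hP g₀ os))
              (fun K t x => weightA₁₃ θ hP K₀ g₀ os K t x - (sh F θ hP g₀ os).1 K t x)
              (fun K t x => weightB₁₃ θ hP K₀ g₀ os K t x - (sh F θ hP g₀ os).2 K t x) δ ∧ Summable δ)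
    (F : T4Family) (θ : Stage13HParams F N) (hP : θ.Provisos₁₃CoPH F N) (hRg : Rg F θ) (hθ : θ.Admissible F N) :
    ForSmallCouplings (datumOfRecord₁₃CoPH F N θ hP) fun g₀ => StringwiseHybridNE7 ((datumOfRecord₁₃CoPH F N θ hP).scheme g₀) := by
  obtain ⟨hdec, h18⟩ := kernelRowsOfRecord₁₃_guarded_of_kingMechanismZ4 ℓ q p₁ p₂ uA vA CA uB vB CB κK θK sA sC sB cA cC cB Rg hs hks hq hd hEA hEB hu hCA hvA hCB hvB hdu hdC hdv hdom
  exact bodyBFree₁₃CoPH_of_kernels_pin_at_crOfRecord₁₃VAt_cut K₀ jc sh β 𝔯 ksel ℓ Rg hpin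
    (fun F θ hP hRg hθ => ForSmallCouplings.of_forall fun g₀ os => by
      refine ⟨?_, ?_, ?_⟩
      · exact n14At_rateCarriersOfRecord₁₃CoPH_of_pinned 𝔯 hpin1 F θ hP g₀ os (ksel F θ hP g₀ os)
      · obtain ⟨b, aS, ν, μ, α, β', c35, p, hb, haS, h⟩ := hpin2
        rw [h F θ hP g₀ os]
        exact n15At_fullGSizedObjects_family hb haS ν μ α β' c35 p F
      · show N16HolderAt (rateCarriersOfRecord₁₃CoPH 𝔯 F θ hP g₀ os (ksel F θ hP g₀ os)).ne3 β
        rw [rateCarriers_ne3_of_pinnedLoose hpinL F θ hP g₀ os (ksel F θ hP g₀ os)]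
        exact h16 F ⟨θ, hP, hRg, hθ⟩)
    hs hκ hcr hρ hdec h18
    (fun F θ hP hRg hθ k => n22At_u3OfRecord₁₃_objectsOfRecord₁₃_of_geometricIncrements_of_windowedNE9 F N θ.toStage13Params (ℓ F θ) (hs F θ hP hRg hθ) k (hr F θ hP hRg hθ)
      (hinc F θ hP hRg hθ) (h9 F θ hP hRg hθ))
    hsel hζm h20 h21 h19 F θ hP hRg hθ

end KingZ4

end Summit.QuantumFields.YangMills.Theorems.BalabanUVNodesN27SpineRecord
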